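/-
Copyright: cell pub-balaban-gaps (YM BLITZ Y1, track G1), seat g1-p2 GEN 9 (unit `pub-balaban-gaps-g1-p2`).  Row (D4) NODE O,
OBJECT level, FIBRE ALGEBRA of the ADJOINT REPRESENTATION: print's covariant derivative on 𝔤-valued functions transports by
`R(U)X = UXU⁻¹` ([B9] p. 390, (3.19), (3.23)), i.e. by the bond field `conjOp U U⁻¹` on the pair fibre `Fin N × Fin N`
(`D4WalkBlockTransportAlgebra`).  This file derives, from TWO-SIDED (row- and column-sum) windows on a bond field `U` of the
fundamental representation — or on `X` for `U = e^{X}` — the three (3.37)-shape windows that the Cor. 3.5 steps consume for the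
ADJOINT bond field (`conjOp U U⁻¹ − 1`, `conjOp U⁻¹ U − 1`, and the discrete derivative `conjOp U(x)U(x)⁻¹ − conjOp U(x′)U(x′)⁻¹`),
the inverse identity `conjOp U U⁻¹ · conjOp U⁻¹ U = 1`, and holomorphy of the adjoint entries.  HONEST FRAMING: elementary matrix
algebra; nothing of Bałaban's asserted; (D4) instance 0∕1; NOT BetaPertH, NOT continuum, NOT Clay.
-/
import Summits.QuantumFields.BalabanUV.Gaps.D4WalkBlockExpWindow

/-!
# `Gaps.D4WalkBlockAdjointWindow` — the adjoint-representation bond field `conjOp U U⁻¹`: inverse identity, (3.37)-shape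
# windows from two-sided windows of `U` ∕ of `X` (`U = e^{X}`), holomorphy (cell pub-balaban-gaps, seat g1-p2 gen 9)

HONEST DEPENDENCY (cell pub-balaban, verbatim): continuum YM on T⁴ ⇐ BetaPertH ∧ nine spine estimates (0/9 proved);
BetaPertH ⇐ (D1) ∧ (D4) ∧ CAP+tail.

The Cor. 3.5 steps of this lineage take a bond field `U` with values in `Matrix F F ℂ` on an arbitrary finite fibre `F` and
windows stated as FIBRE ROW SUMS `Σ_b ‖(U − 1)_{ab}‖ ≤ α₀·t`, `Σ_b ‖(U⁻¹ − 1)_{ab}‖ ≤ α₀·t`, `Σ_b ‖(U(x) − U(x′))_{ab}‖ ≤ α₁·t²`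
(`t = L^{−lev}` ≤ 1).  For the adjoint representation `F = Fin N × Fin N`, `U ↦ conjOp U U⁻¹`, the fibre row sum at `(a, b)` is
`rowSum(·)_a · colSum(·)_b` (`D4WalkBlockTransportAlgebra.rowMass_conjOp`), so the adjoint windows follow from ROW AND COLUMN
windows of the fundamental field:
* §1 `conjOp_mul_conjOp` (`conjOp A A′ · conjOp B B′ = conjOp (AB) (B′A′)`), **`conjOp_mul_conjOp_eq_one`** (`UU⁻ = 1 ⟹
  conjOp U U⁻ · conjOp U⁻ U = 1`), `conjOp_sub_conjOp`, **`conjOp_holo`** (entries of `u ↦ conjOp (U u) (U′ u)` holomorphic);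
* §2 **`rowMass_adjBond_le`** (`row(U − 1) ≤ αt`, `col(U⁻ − 1) ≤ αt`, `0 ≤ t ≤ 1` ⟹ fibre row sums of `conjOp U U⁻ − 1` at most
  `α(2 + α)·t`), **`rowMass_adjDeriv_le`** (fibre row sums of `conjOp U U⁻ − conjOp V V⁻` at most `(1 + α)(β + β′)` from
  `row(U − V) ≤ β`, `col(U⁻ − V⁻) ≤ β′`, `row(V − 1) ≤ α`, `col(U⁻ − 1) ≤ α`), `colSumNorm_inv_sub_inv_le` (`col(U⁻ − V⁻) ≤ (1 + α)²β`
  from `col(U − V) ≤ β` by `U⁻ − V⁻ = −U⁻(U − V)V⁻`);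
* §3 `U = e^{X}`: **`rowMass_adjBond_exp_le`** (two-sided `Σ|X| ≤ a₀t` ⟹ both adjoint bond windows with `α = a₀e^{a₀}`),
  **`rowMass_adjDeriv_exp_le`** (two-sided `Σ|X|, Σ|Y| ≤ s`, `Σ|X − Y| ≤ a₁t²` ⟹ adjoint derivative window `2a₁e^{2s}·t²`),
  `conjOp_exp_mul_eq_one`.
USE: the staged multi-level Green-function END (`D4WalkBlockCovariantGreenMultiLevel`, fibre-generic) instantiated at the pair fibre
with these windows is the ADJOINT-representation twin (a corollary on the staged chain).  Value: bookkeeping; words of row (D4) UNCHANGED.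

References: T. Bałaban, Comm. Math. Phys. **99** (1985) 389–434 [B9], p. 390 («R(U)X = UXU⁻¹»), (3.19) p. 393, (3.23) p. 394, (3.37) p. 396,
(3.50)–(3.54) pp. 400–401, Cor. 3.5 p. 407.
-/

noncomputable section

namespace Summit.QuantumFields.BalabanUV.Gaps.D4WalkBlockAdjointWindow

open Metric Set Finset NormedSpace
open scoped Matrix
open Summit.QuantumFields.BalabanUV.Gaps.D4WalkBlockTransportAlgebra (conjOp rowSumNorm colSumNorm rowSumNorm_nonneg colSumNorm_nonneg
  rowMass_conjOp conjOp_one_one conjOp_sub_left conjOp_sub_right rowMass_add_le rowMass_defect_le colSumNorm_mul_le rowSumNorm_mul_le)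
open Summit.QuantumFields.BalabanUV.Gaps.D4WalkBlockExpWindow (rowSumNorm_neg colSumNorm_neg rowSumNorm_exp_sub_one_le
  colSumNorm_exp_sub_one_le rowSumNorm_exp_sub_exp_le colSumNorm_exp_sub_exp_le exp_sub_one_le_eps)

variable {N : ℕ}

/-! ## §1. Algebra of the adjoint bond field: products, the inverse identity, differences, holomorphy -/

/-- `conjOp A A′ · conjOp B B′ = conjOp (AB) (B′A′)` (`X ↦ A(BXB′)A′`). [cite: Balaban1985BackgroundPropagators, p.390] -/
theorem conjOp_mul_conjOp (A A' B B' : Matrix (Fin N) (Fin N) ℂ) :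
    conjOp A A' * conjOp B B' = conjOp (A * B) (B' * A') := by
  ext p q
  simp only [Matrix.mul_apply, conjOp, Matrix.of_apply]
  rw [Fintype.sum_prod_type]
  simp only [Finset.sum_mul, Finset.mul_sum]
  rw [Finset.sum_comm]
  refine Finset.sum_congr rfl fun c _ => Finset.sum_congr rfl fun e _ => by ring

/-- **THE INVERSE IDENTITY**: `UU⁻ = 1 ⟹ conjOp U U⁻ · conjOp U⁻ U = 1` (`R(U)R(U⁻¹) = 1`). [cite: Balaban1985BackgroundPropagators, p.390] -/
theorem conjOp_mul_conjOp_eq_one (U Ui : Matrix (Fin N) (Fin N) ℂ) (hU : U * Ui = 1) :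
    conjOp U Ui * conjOp Ui U = 1 := by
  rw [conjOp_mul_conjOp, hU, conjOp_one_one]

/-- Difference of two adjoint transporters: `conjOp U U⁻ − conjOp V V⁻ = conjOp (U − V) U⁻ + conjOp V (U⁻ − V⁻)`.
[cite: Balaban1985BackgroundPropagators, (3.51) p.400] -/
theorem conjOp_sub_conjOp (U Ui V Vi : Matrix (Fin N) (Fin N) ℂ) :
    conjOp U Ui - conjOp V Vi = conjOp (U - V) Ui + conjOp V (Ui - Vi) := by
  rw [conjOp_sub_left, conjOp_sub_right]; abel

/-- **HOLOMORPHY of the adjoint entries**: if the entries of `u ↦ U u` and `u ↦ U′ u` are holomorphic on `s`, so are the entries of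
`u ↦ conjOp (U u) (U′ u)` (products). [cite: Balaban1985BackgroundPropagators, Cor. 3.5 p.407] -/
theorem conjOp_holo {E : Type*} [NormedAddCommGroup E] [NormedSpace ℂ E] {U U' : E → Matrix (Fin N) (Fin N) ℂ} {s : Set E}
    (hU : ∀ a b, DifferentiableOn ℂ (fun u => U u a b) s) (hU' : ∀ a b, DifferentiableOn ℂ (fun u => U' u a b) s)
    (p q : Fin N × Fin N) : DifferentiableOn ℂ (fun u => conjOp (U u) (U' u) p q) s := by
  simp only [conjOp, Matrix.of_apply]
  exact (hU p.1 q.1).mul (hU' q.2 p.2)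

/-! ## §2. The adjoint windows from two-sided windows of the fundamental field -/

/-- row sums of `1 + W` are at most `1 + (row sums of W)`. -/
theorem rowSumNorm_le_one_add (V : Matrix (Fin N) (Fin N) ℂ) {α : ℝ} (hV : ∀ a, rowSumNorm (V - 1) a ≤ α) (a : Fin N) :
    rowSumNorm V a ≤ 1 + α := by
  have e : V = 1 + (V - 1) := by abel
  have h1 : rowSumNorm (1 : Matrix (Fin N) (Fin N) ℂ) a = 1 := by
    simp only [rowSumNorm, Matrix.one_apply]
    rw [Finset.sum_eq_single a (fun c _ hc => by rw [if_neg (Ne.symm hc), norm_zero]) (fun h => (h (Finset.mem_univ a)).elim)]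
    simp
  calc rowSumNorm V a = rowSumNorm (1 + (V - 1)) a := by rw [← e]
    _ ≤ rowSumNorm (1 : Matrix (Fin N) (Fin N) ℂ) a + rowSumNorm (V - 1) a := by
        unfold rowSumNorm; rw [← Finset.sum_add_distrib]
        exact Finset.sum_le_sum fun c _ => by rw [Matrix.add_apply]; exact norm_add_le _ _
    _ ≤ 1 + α := by rw [h1]; linarith [hV a]

/-- column sums of `1 + W` are at most `1 + (column sums of W)`. -/
theorem colSumNorm_le_one_add (V : Matrix (Fin N) (Fin N) ℂ) {α : ℝ} (hV : ∀ b, colSumNorm (V - 1) b ≤ α) (b : Fin N) :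
    colSumNorm V b ≤ 1 + α := by
  have e : V = 1 + (V - 1) := by abel
  have h1 : colSumNorm (1 : Matrix (Fin N) (Fin N) ℂ) b = 1 := by
    simp only [colSumNorm, Matrix.one_apply]
    rw [Finset.sum_eq_single b (fun d _ hd => by rw [if_neg hd, norm_zero]) (fun h => (h (Finset.mem_univ b)).elim)]
    simp
  calc colSumNorm V b = colSumNorm (1 + (V - 1)) b := by rw [← e]
    _ ≤ colSumNorm (1 : Matrix (Fin N) (Fin N) ℂ) b + colSumNorm (V - 1) b := by
        unfold colSumNorm; rw [← Finset.sum_add_distrib]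
        exact Finset.sum_le_sum fun d _ => by rw [Matrix.add_apply]; exact norm_add_le _ _
    _ ≤ 1 + α := by rw [h1]; linarith [hV b]

/-- **THE ADJOINT BOND WINDOW, (3.37)-shape**: `row(U − 1) ≤ α·t`, `col(U⁻ − 1) ≤ α·t` with `0 ≤ t ≤ 1`, `0 ≤ α` ⟹ every fibre
row sum of `conjOp U U⁻ − 1` is at most `α(2 + α)·t`. [cite: Balaban1985BackgroundPropagators, (3.37) p.396, (3.54) p.401] -/
theorem rowMass_adjBond_le (U Ui : Matrix (Fin N) (Fin N) ℂ) {α t : ℝ} (hα : 0 ≤ α) (ht : 0 ≤ t) (ht1 : t ≤ 1)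
    (hU : ∀ a, rowSumNorm (U - 1) a ≤ α * t) (hUi : ∀ b, colSumNorm (Ui - 1) b ≤ α * t) (p : Fin N × Fin N) :
    ∑ q, ‖(conjOp U Ui - 1) p q‖ ≤ α * (2 + α) * t := by
  obtain ⟨a, b⟩ := p
  have hcol : colSumNorm Ui b ≤ 1 + α := by
    refine (colSumNorm_le_one_add Ui (α := α * t) hUi b).trans ?_
    have : α * t ≤ α := mul_le_of_le_one_right hα ht1
    linarith
  refine (rowMass_defect_le U Ui a b).trans ?_
  calc rowSumNorm (U - 1) a * colSumNorm Ui b + colSumNorm (Ui - 1) b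
      ≤ α * t * (1 + α) + α * t := add_le_add (mul_le_mul (hU a) hcol (colSumNorm_nonneg _ _) (by positivity)) (hUi b)
    _ = α * (2 + α) * t := by ring

/-- **THE ADJOINT DERIVATIVE WINDOW**: from `row(U − V) ≤ β`, `col(U⁻ − V⁻) ≤ β′`, `row(V − 1) ≤ α`, `col(U⁻ − 1) ≤ α` (`0 ≤ α`):
every fibre row sum of `conjOp U U⁻ − conjOp V V⁻` is at most `(1 + α)(β + β′)`. [cite: Balaban1985BackgroundPropagators, (3.37) p.396, (3.51)–(3.54) pp.400–401] -/
theorem rowMass_adjDeriv_le (U Ui V Vi : Matrix (Fin N) (Fin N) ℂ) {α β β' : ℝ} (hα : 0 ≤ α)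
    (hUV : ∀ a, rowSumNorm (U - V) a ≤ β) (hUVi : ∀ b, colSumNorm (Ui - Vi) b ≤ β')
    (hV : ∀ a, rowSumNorm (V - 1) a ≤ α) (hUi : ∀ b, colSumNorm (Ui - 1) b ≤ α) (p : Fin N × Fin N) :
    ∑ q, ‖(conjOp U Ui - conjOp V Vi) p q‖ ≤ (1 + α) * (β + β') := by
  obtain ⟨a, b⟩ := p
  have hβ : 0 ≤ β := (rowSumNorm_nonneg _ a).trans (hUV a)
  have hβ' : 0 ≤ β' := (colSumNorm_nonneg _ b).trans (hUVi b)
  rw [conjOp_sub_conjOp]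
  refine (rowMass_add_le _ _ _).trans ?_
  rw [rowMass_conjOp, rowMass_conjOp]
  calc rowSumNorm (U - V) a * colSumNorm Ui b + rowSumNorm V a * colSumNorm (Ui - Vi) b
      ≤ β * (1 + α) + (1 + α) * β' :=
        add_le_add (mul_le_mul (hUV a) (colSumNorm_le_one_add Ui hUi b) (colSumNorm_nonneg _ _) hβ)
          (mul_le_mul (rowSumNorm_le_one_add V hV a) (hUVi b) (colSumNorm_nonneg _ _) (by positivity))
    _ = (1 + α) * (β + β') := by ring

/-- Column window of the INVERSES' difference from the column window of the fields' difference: `UU⁻ = 1`, `V⁻V = 1` ⟹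
`U⁻ − V⁻ = −U⁻(U − V)V⁻`, so `col(U⁻ − V⁻) ≤ (1 + α)²·β` from `col(U − V) ≤ β`, `col(U⁻ − 1), col(V⁻ − 1) ≤ α`.
[cite: Balaban1985BackgroundPropagators, (3.51) p.400] -/
theorem colSumNorm_inv_sub_inv_le (U Ui V Vi : Matrix (Fin N) (Fin N) ℂ) (hU : Ui * U = 1) (hV : V * Vi = 1) {α β : ℝ}
    (hα : 0 ≤ α) (hUV : ∀ b, colSumNorm (U - V) b ≤ β) (hUi : ∀ b, colSumNorm (Ui - 1) b ≤ α)
    (hVi : ∀ b, colSumNorm (Vi - 1) b ≤ α) (b : Fin N) : colSumNorm (Ui - Vi) b ≤ (1 + α) ^ 2 * β := by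
  have hβ : 0 ≤ β := (colSumNorm_nonneg _ b).trans (hUV b)
  have e : Ui - Vi = -(Ui * ((U - V) * Vi)) := by
    rw [sub_mul, mul_sub, ← mul_assoc, ← mul_assoc, hU, one_mul, mul_assoc, hV, mul_one]; abel
  rw [e, colSumNorm_neg]
  calc colSumNorm (Ui * ((U - V) * Vi)) b ≤ (1 + α) * colSumNorm ((U - V) * Vi) b :=
        colSumNorm_mul_le _ _ (colSumNorm_le_one_add Ui hUi) b
    _ ≤ (1 + α) * (β * colSumNorm Vi b) :=
        mul_le_mul_of_nonneg_left (colSumNorm_mul_le _ _ hUV b) (by positivity)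
    _ ≤ (1 + α) * (β * (1 + α)) :=
        mul_le_mul_of_nonneg_left (mul_le_mul_of_nonneg_left (colSumNorm_le_one_add Vi hVi b) hβ) (by positivity)
    _ = (1 + α) ^ 2 * β := by ring

/-! ## §3. `U = e^{X}`: the adjoint windows from two-sided windows on `X` -/

/-- `e^{X}e^{−X} = 1`, hence `conjOp e^{X} e^{−X} · conjOp e^{−X} e^{X} = 1`. [cite: Balaban1985BackgroundPropagators, p.390] -/
theorem conjOp_exp_mul_eq_one (X : Matrix (Fin N) (Fin N) ℂ) : conjOp (exp X) (exp (-X)) * conjOp (exp (-X)) (exp X) = 1 :=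
  conjOp_mul_conjOp_eq_one _ _ (by
    rw [Matrix.exp_neg]; exact Matrix.mul_nonsing_inv _ ((Matrix.isUnit_iff_isUnit_det _).1 (Matrix.isUnit_exp _)))

/-- **ADJOINT BOND WINDOWS FOR `U = e^{X}`**: two-sided `Σ_c|X_{ac}| ≤ a₀t`, `Σ_c|X_{ca}| ≤ a₀t` (`0 ≤ t ≤ 1`, `0 ≤ a₀`) ⟹ the fibre
row sums of BOTH `conjOp e^{X} e^{−X} − 1` and `conjOp e^{−X} e^{X} − 1` are at most `α(2 + α)·t`, `α = a₀e^{a₀}`.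
[cite: Balaban1985BackgroundPropagators, (3.37) p.396, (3.54) p.401] -/
theorem rowMass_adjBond_exp_le (X : Matrix (Fin N) (Fin N) ℂ) {a₀ t : ℝ} (ha₀ : 0 ≤ a₀) (ht : 0 ≤ t) (ht1 : t ≤ 1)
    (hXr : ∀ a, rowSumNorm X a ≤ a₀ * t) (hXc : ∀ b, colSumNorm X b ≤ a₀ * t) :
    (∀ p, ∑ q, ‖(conjOp (exp X) (exp (-X)) - 1) p q‖ ≤ (a₀ * Real.exp a₀) * (2 + a₀ * Real.exp a₀) * t) ∧
    (∀ p, ∑ q, ‖(conjOp (exp (-X)) (exp X) - 1) p q‖ ≤ (a₀ * Real.exp a₀) * (2 + a₀ * Real.exp a₀) * t) := by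
  have hs : 0 ≤ t * a₀ := by positivity
  have hε := exp_sub_one_le_eps ht ht1 ha₀
  -- the four one-sided letters of e^{±X} − 1, all ≤ (a₀e^{a₀})·t
  have hr : ∀ Y : Matrix (Fin N) (Fin N) ℂ, (∀ a, rowSumNorm Y a ≤ a₀ * t) →
      ∀ a, rowSumNorm (exp Y - 1) a ≤ (a₀ * Real.exp a₀) * t := fun Y hY a =>
    ((rowSumNorm_exp_sub_one_le Y hs (fun c => by rw [mul_comm]; exact hY c) a).trans hε).trans (le_of_eq (by ring))
  have hc : ∀ Y : Matrix (Fin N) (Fin N) ℂ, (∀ b, colSumNorm Y b ≤ a₀ * t) →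
      ∀ b, colSumNorm (exp Y - 1) b ≤ (a₀ * Real.exp a₀) * t := fun Y hY b =>
    ((colSumNorm_exp_sub_one_le Y hs (fun c => by rw [mul_comm]; exact hY c) b).trans hε).trans (le_of_eq (by ring))
  have hXnr : ∀ a, rowSumNorm (-X) a ≤ a₀ * t := fun a => by rw [rowSumNorm_neg]; exact hXr a
  have hXnc : ∀ b, colSumNorm (-X) b ≤ a₀ * t := fun b => by rw [colSumNorm_neg]; exact hXc b
  exact ⟨rowMass_adjBond_le _ _ (by positivity) ht ht1 (hr X hXr) (hc (-X) hXnc),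
    rowMass_adjBond_le _ _ (by positivity) ht ht1 (hr (-X) hXnr) (hc X hXc)⟩

/-- **ADJOINT DERIVATIVE WINDOW FOR `U = e^{X}`, `V = e^{Y}`** (neighbouring bonds): two-sided `Σ|X|, Σ|Y| ≤ s`, two-sided
`Σ|X − Y| ≤ a₁t²` (`0 ≤ s`, `0 ≤ a₁t²`) ⟹ the fibre row sums of `conjOp e^{X} e^{−X} − conjOp e^{Y} e^{−Y}` are at most `2a₁e^{2s}·t²`.
[cite: Balaban1985BackgroundPropagators, (3.37) p.396, (3.51)–(3.54) pp.400–401] -/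
theorem rowMass_adjDeriv_exp_le (X Y : Matrix (Fin N) (Fin N) ℂ) {s a₁ t : ℝ} (hs : 0 ≤ s) (ha₁t : 0 ≤ a₁ * t ^ 2)
    (hXr : ∀ a, rowSumNorm X a ≤ s) (hXc : ∀ b, colSumNorm X b ≤ s) (hYr : ∀ a, rowSumNorm Y a ≤ s) (hYc : ∀ b, colSumNorm Y b ≤ s)
    (hDr : ∀ a, rowSumNorm (X - Y) a ≤ a₁ * t ^ 2) (hDc : ∀ b, colSumNorm (X - Y) b ≤ a₁ * t ^ 2) (p : Fin N × Fin N) :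
    ∑ q, ‖(conjOp (exp X) (exp (-X)) - conjOp (exp Y) (exp (-Y))) p q‖ ≤ 2 * a₁ * Real.exp (2 * s) * t ^ 2 := by
  have hXnc : ∀ b, colSumNorm (-X) b ≤ s := fun b => by rw [colSumNorm_neg]; exact hXc b
  have hYnc : ∀ b, colSumNorm (-Y) b ≤ s := fun b => by rw [colSumNorm_neg]; exact hYc b
  have hDnc : ∀ b, colSumNorm (-X - -Y) b ≤ a₁ * t ^ 2 := fun b => by
    rw [show -X - -Y = -(X - Y) by abel, colSumNorm_neg]; exact hDc b
  -- row(e^X − e^Y) ≤ a₁t²e^s ; col(e^{−X} − e^{−Y}) ≤ a₁t²e^s ; row(e^Y − 1), col(e^{−X} − 1) ≤ e^s − 1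
  have h1 := rowSumNorm_exp_sub_exp_le X Y hs ha₁t hXr hYr hDr
  have h2 := colSumNorm_exp_sub_exp_le (-X) (-Y) hs ha₁t hXnc hYnc hDnc
  have h3 : ∀ a, rowSumNorm (exp Y - 1) a ≤ Real.exp s - 1 := rowSumNorm_exp_sub_one_le Y hs hYr
  have h4 : ∀ b, colSumNorm (exp (-X) - 1) b ≤ Real.exp s - 1 := colSumNorm_exp_sub_one_le (-X) hs hXnc
  have hα : 0 ≤ Real.exp s - 1 := by linarith [Real.add_one_le_exp s]
  refine (rowMass_adjDeriv_le _ _ _ _ hα h1 h2 h3 h4 p).trans (le_of_eq ?_)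
  have : (1 : ℝ) + (Real.exp s - 1) = Real.exp s := by ring
  rw [this, show (2 : ℝ) * s = s + s by ring, Real.exp_add]; ring

end Summit.QuantumFields.BalabanUV.Gaps.D4WalkBlockAdjointWindow

end
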